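import Summits.CriticalPhenomena.PercolationContinuityZ3.Theorems.PercNearOneGluingNoHeavyLowerTailQuantitativeHarrisProductWeightSections
import HarnessLib

/-!
# The TWO-ATOM FLOOR of Harris' inequality (sharp explicit strictness, cube form)
# (`q_e(1−q_e)·D_e f(η₁)·D_e g(η₂)·Π_{i≠e} m_i(η₁,η₂) ≤ Cov(f,g)`, `m_i = q_i / 1−q_i / q_i(1−q_i)` as `η₁ i = η₂ i = 1 / = 0 / differ)

Support file (`--supports stmt-CriticalPhenomena-4575`), prover seat `prim-rate-mine-2` (lane prim-rate, constants-miner (c), BENCH row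
M2-R48; `run/shared/lean/prim/prim-rate/prim-rate-mine-2/PROOFS.md` §P48).  No definitions, no named facts, no sorries; standard axioms.

Row M2-R47 (`QuantHarris.cov_ge_pow_mul_jumps`) floored the covariance of two increasing functions by `p₀^{2|E|+2}·J₁·J₂` from two SEPARATE
influence witnesses of one coordinate (the influence-product floor, each influence floored by one atom); the exponent `2|E|` is an artefact
of multiplying two one-atom floors.  THIS FILE proves the sharp form on the cube `ι → Bool` (product weight `prodWeight q`, `q ∈ [0,1]^ι`,
nonnegative monotone `f, g`, ANY coordinate `e`, ANY configurations `η₁, η₂`; `D_e f = QuantHarris.pivDiff e f`):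

* `QuantHarris.cov_ge_twoAtom`: `q_e(1−q_e) · D_e f(η₁) · D_e g(η₂) · Π_{i ≠ e} m_i(η₁,η₂) ≤ E(fg) − E f·E g`,
  `m_i = q_i` if `η₁ i = η₂ i = 1`, `1 − q_i` if `η₁ i = η₂ i = 0`, `q_i(1−q_i)` if `η₁ i ≠ η₂ i`.
  For `η₁ = η₂` this is the one-atom case of the joint-influence floor `q_e(1−q_e)·E[D_e f·D_e g] ≤ Cov` (row M2-R1); the content is
  `η₁ ≠ η₂` (no common pivotal configuration, e.g. `f = x_e ∧ x_a`, `g = x_e ∨ x_a`): a coordinate on which the witnesses DISAGREE costs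
  exactly `q_i(1−q_i)`.  Equality: `f = AND`, `g = OR`, `η₁ = 1`, `η₂ = 0` (`QuantHarris.cov_and_or_eq_prod`).
  PROOF (`cov_ge_twoAtom_aux`, strong induction on the set `S` of free coordinates `≠ e`): a coordinate on which `η₁, η₂` agree is frozen
  at the common value (`cov_section_le`); when they disagree on all of `S`, split along some `a ∈ S` (`twoAtom_mixed_step`): the two
  sections are floored by induction (jumps `A, C` and `B, D`), the influence term `q_a(1−q_a)·E[D_a f]·E[D_a g]` by the two COMPLEMENTARY
  cylinders through `η₁^{e→1}` and `η₂^{e→0}` (`cyl_mul_le_ex`), whose masses multiply to `q_e(1−q_e)·Π_{S∖a} q_i(1−q_i)` exactly, with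
  `D_a f(η₁^{e→1}) ≥ A − B`, `D_a g(η₂^{e→0}) ≥ D − C`; the pieces add up by
  `qAC + (1−q)BD + q(1−q)(A−B)(D−C) − q(1−q)AD = q²AC + (1−q)²BD + q(1−q)BC ≥ 0` (`mixed_step_arith`).
The witness-free constant `Π_i q_i(1−q_i)`, the transfer to `prodBernoulli` and the support form `(p₀(1−p₀))^{|E|}·J₁J₂ ≤ Cov` are in
`…QuantitativeHarrisSharpStrictness.lean`.
Census before proof (lane rule, exact rationals): every pair of monotone Boolean functions on `m ≤ 3` coordinates × every `e, η₁, η₂` ×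
weights in `{1/10,3/10,1/2,7/10,9/10}^m` (254 305 instances), `m = 4` (4.3·10⁶, float), random real-valued monotone pairs `m ≤ 5`: 0 violations,
`min Cov/floor = 1`.
[cite: Harris1960, Lemma 4.1 (p. 16)] [cite: Talagrand1996, Thm. 1.1 (p. 244)]
-/

noncomputable section

namespace Summit.CriticalPhenomena.PercolationContinuityZ3.Theorems

namespace QuantHarris

open Finset Literature.Combinatorics.Sahi2008 SahiSubsetChord SahiCoSingleton

variable {ι : Type*} [Fintype ι] [DecidableEq ι]

/-! ### The two-atom floor -/

omit [Fintype ι] in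
/-- Updating at `a ≠ e` with the value already there, after an update at `e`, changes nothing. [folklore] -/
theorem update_update_of_eq (x : ι → Bool) (e a : ι) (hae : a ≠ e) (c b : Bool) (h : x a = b) :
    Function.update (Function.update x e c) a b = Function.update x e c := by
  funext i
  rcases eq_or_ne i a with rfl | hia
  · rw [Function.update_self, Function.update_of_ne hae, h]
  · rw [Function.update_of_ne hia]

/-- The real arithmetic of the mixed step: `qAC + (1−q)BD + q(1−q)(A−B)(D−C) ≥ q(1−q)AD` for nonnegative `A, B, C, D`, `q ∈ [0,1]`
(the difference is `q²AC + (1−q)²BD + q(1−q)BC`), dressed with the section covariances and the influence product. [this file] -/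
theorem mixed_step_arith {qa K P A B C D c₁ c₀ X Y : ℝ} (hqa0 : 0 ≤ qa) (hqa1 : 0 ≤ 1 - qa) (hK : 0 ≤ K) (hP : 0 ≤ P)
    (hA : 0 ≤ A) (hB : 0 ≤ B) (hC : 0 ≤ C) (hD : 0 ≤ D) (hX : 0 ≤ X) (hY : 0 ≤ Y)
    (I1 : K * (A * C) * P ≤ c₁) (I0 : K * (B * D) * P ≤ c₀)
    (hXY : B < A → C < D → K * P * ((A - B) * (D - C)) ≤ X * Y) :
    K * (A * D) * (qa * (1 - qa) * P) ≤ qa * c₁ + (1 - qa) * c₀ + qa * (1 - qa) * (X * Y) := by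
  have J1 := mul_le_mul_of_nonneg_left I1 hqa0
  have J0 := mul_le_mul_of_nonneg_left I0 hqa1
  have hXY0 : 0 ≤ qa * (1 - qa) * (X * Y) := mul_nonneg (mul_nonneg hqa0 hqa1) (mul_nonneg hX hY)
  have hKP : 0 ≤ K * P := mul_nonneg hK hP
  have hADP : 0 ≤ K * (A * D) * P := mul_nonneg (mul_nonneg hK (mul_nonneg hA hD)) hP
  have hc1 : 0 ≤ qa * c₁ := le_trans (mul_nonneg hqa0 (mul_nonneg (mul_nonneg hK (mul_nonneg hA hC)) hP)) J1
  have hc0 : 0 ≤ (1 - qa) * c₀ := le_trans (mul_nonneg hqa1 (mul_nonneg (mul_nonneg hK (mul_nonneg hB hD)) hP)) J0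
  have hqa1' : qa ≤ 1 := by linarith
  have hqa0' : 1 - qa ≤ 1 := by linarith
  by_cases hBA : A ≤ B
  · -- the `0`-section alone suffices
    have h1 : K * (A * D) * P ≤ K * (B * D) * P :=
      mul_le_mul_of_nonneg_right (mul_le_mul_of_nonneg_left (mul_le_mul_of_nonneg_right hBA hD) hK) hP
    have h2 : (1 - qa) * (K * (A * D) * P) ≤ (1 - qa) * (K * (B * D) * P) := mul_le_mul_of_nonneg_left h1 hqa1
    have h3 : qa * ((1 - qa) * (K * (A * D) * P)) ≤ 1 * ((1 - qa) * (K * (A * D) * P)) :=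
      mul_le_mul_of_nonneg_right hqa1' (mul_nonneg hqa1 hADP)
    have hid : K * (A * D) * (qa * (1 - qa) * P) = qa * ((1 - qa) * (K * (A * D) * P)) := by ring
    rw [hid]
    linarith
  by_cases hCD : D ≤ C
  · have h1 : K * (A * D) * P ≤ K * (A * C) * P :=
      mul_le_mul_of_nonneg_right (mul_le_mul_of_nonneg_left (mul_le_mul_of_nonneg_left hCD hA) hK) hP
    have h2 : qa * (K * (A * D) * P) ≤ qa * (K * (A * C) * P) := mul_le_mul_of_nonneg_left h1 hqa0
    have h3 : (1 - qa) * (qa * (K * (A * D) * P)) ≤ 1 * (qa * (K * (A * D) * P)) :=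
      mul_le_mul_of_nonneg_right hqa0' (mul_nonneg hqa0 hADP)
    have hid : K * (A * D) * (qa * (1 - qa) * P) = (1 - qa) * (qa * (K * (A * D) * P)) := by ring
    rw [hid]
    linarith
  push Not at hBA hCD
  have JXY := mul_le_mul_of_nonneg_left (hXY hBA hCD) (mul_nonneg hqa0 hqa1)
  nlinarith [mul_nonneg hKP (mul_nonneg (mul_nonneg hqa0 hqa0) (mul_nonneg hA hC)),
    mul_nonneg hKP (mul_nonneg (mul_nonneg hqa1 hqa1) (mul_nonneg hB hD)),
    mul_nonneg hKP (mul_nonneg (mul_nonneg hqa0 hqa1) (mul_nonneg hB hC))]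

/-- **The mixed step.**  The witnesses disagree at `a` (`η₁ a = 1`, `η₂ a = 0`) and at every other free coordinate (`S'`); given the
two-atom floor for functions of the coordinates `insert e S'` (hypothesis `ih`), it holds for functions of `insert e (insert a S')`
with the extra factor `q_a(1−q_a)`. [this file] -/
theorem twoAtom_mixed_step {q : ι → ℝ} (hq : ∀ i, 0 ≤ q i ∧ q i ≤ 1) (e a : ι) (hae : a ≠ e) (S' : Finset ι) (heS' : e ∉ S')
    (f g : (ι → Bool) → ℝ) (hf0 : ∀ x, 0 ≤ f x) (hg0 : ∀ x, 0 ≤ g x) (hf : Monotone f) (hg : Monotone g)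
    (hfS : ∀ x a' b, a' ∉ insert e (insert a S') → f (Function.update x a' b) = f x)
    (hgS : ∀ x a' b, a' ∉ insert e (insert a S') → g (Function.update x a' b) = g x)
    (η₁ η₂ : ι → Bool) (h1 : η₁ a = true) (h2 : η₂ a = false) (hmix : ∀ i ∈ S', η₁ i ≠ η₂ i)
    (ih : ∀ f' g' : (ι → Bool) → ℝ, (∀ x, 0 ≤ f' x) → (∀ x, 0 ≤ g' x) → Monotone f' → Monotone g' →
      (∀ x a' b, a' ∉ insert e S' → f' (Function.update x a' b) = f' x) →
      (∀ x a' b, a' ∉ insert e S' → g' (Function.update x a' b) = g' x) →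
      q e * (1 - q e) * (pivDiff e f' η₁ * pivDiff e g' η₂) * (∏ i ∈ S', q i * (1 - q i))
        ≤ ex (prodWeight q) (f' * g') - ex (prodWeight q) f' * ex (prodWeight q) g') :
    q e * (1 - q e) * (pivDiff e f η₁ * pivDiff e g η₂) * (q a * (1 - q a) * ∏ i ∈ S', q i * (1 - q i))
      ≤ ex (prodWeight q) (f * g) - ex (prodWeight q) f * ex (prodWeight q) g := by
  have hw : ∀ y, 0 ≤ prodWeight q y := prodWeight_nonneg hq
  -- sections ignore updates outside `insert e S'`
  have hT : ∀ a', a' ∉ insert e S' → a' ≠ a → a' ∉ insert e (insert a S') := by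
    intro a' ha' hne h'
    rcases Finset.mem_insert.1 h' with rfl | h''
    · exact ha' (Finset.mem_insert_self _ _)
    · rcases Finset.mem_insert.1 h'' with rfl | h3
      · exact hne rfl
      · exact ha' (Finset.mem_insert_of_mem h3)
  have hf1S := section_update_eq hfS a true hT
  have hf0S := section_update_eq hfS a false hT
  have hg1S := section_update_eq hgS a true hT
  have hg0S := section_update_eq hgS a false hT
  -- the four jumps at `e` of the sections
  have hA0 : 0 ≤ pivDiff e (fun x => f (Function.update x a true)) η₁ := pivDiff_nonneg (monotone_comp_update hf a true) e η₁
  have hB0 : 0 ≤ pivDiff e (fun x => f (Function.update x a false)) η₁ := pivDiff_nonneg (monotone_comp_update hf a false) e η₁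
  have hC0 : 0 ≤ pivDiff e (fun x => g (Function.update x a true)) η₂ := pivDiff_nonneg (monotone_comp_update hg a true) e η₂
  have hD0 : 0 ≤ pivDiff e (fun x => g (Function.update x a false)) η₂ := pivDiff_nonneg (monotone_comp_update hg a false) e η₂
  -- `A = D_e f(η₁)` and `D = D_e g(η₂)`
  have hAf : pivDiff e f η₁ = pivDiff e (fun x => f (Function.update x a true)) η₁ := by
    simp only [pivDiff, update_update_of_eq η₁ e a hae _ true h1]
  have hDg : pivDiff e g η₂ = pivDiff e (fun x => g (Function.update x a false)) η₂ := by
    simp only [pivDiff, update_update_of_eq η₂ e a hae _ false h2]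
  -- induction hypothesis for the two sections
  have I1 := ih (fun x => f (Function.update x a true)) (fun x => g (Function.update x a true)) (fun x => hf0 _) (fun x => hg0 _)
    (monotone_comp_update hf a true) (monotone_comp_update hg a true) hf1S hg1S
  have I0 := ih (fun x => f (Function.update x a false)) (fun x => g (Function.update x a false)) (fun x => hf0 _) (fun x => hg0 _)
    (monotone_comp_update hf a false) (monotone_comp_update hg a false) hf0S hg0S
  -- cylinder floors for the two influences `E[D_a f]`, `E[D_a g]`
  have hfS' : ∀ x a' b, a' ∉ insert a (insert e S') → f (Function.update x a' b) = f x :=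
    fun x a' b ha' => hfS x a' b (by rwa [Finset.insert_comm])
  have hgS' : ∀ x a' b, a' ∉ insert a (insert e S') → g (Function.update x a' b) = g x :=
    fun x a' b ha' => hgS x a' b (by rwa [Finset.insert_comm])
  have X1 := cyl_mul_le_ex hq (insert e S') (pivDiff a f) (pivDiff_nonneg hf a) (pivDiff_update_eq a hfS')
    (Function.update η₁ e true)
  have X2 := cyl_mul_le_ex hq (insert e S') (pivDiff a g) (pivDiff_nonneg hg a) (pivDiff_update_eq a hgS')
    (Function.update η₂ e false)
  -- the cylinder masses: `q_e·Φ₁` and `(1−q_e)·Φ₂`, `Φ₁Φ₂ = Π_{S'} q_i(1−q_i)`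
  have hc1 : ∏ i ∈ insert e S', (if Function.update η₁ e true i then q i else 1 - q i)
      = q e * ∏ i ∈ S', (if η₁ i then q i else 1 - q i) := by
    rw [Finset.prod_insert heS', Function.update_self, if_pos rfl]
    congr 1
    refine Finset.prod_congr rfl fun i hi => ?_
    rw [Function.update_of_ne (fun h : i = e => heS' (h ▸ hi))]
  have hc2 : ∏ i ∈ insert e S', (if Function.update η₂ e false i then q i else 1 - q i)
      = (1 - q e) * ∏ i ∈ S', (if η₂ i then q i else 1 - q i) := by
    rw [Finset.prod_insert heS', Function.update_self, if_neg Bool.false_ne_true]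
    congr 1
    refine Finset.prod_congr rfl fun i hi => ?_
    rw [Function.update_of_ne (fun h : i = e => heS' (h ▸ hi))]
  have hc12 : (∏ i ∈ S', (if η₁ i then q i else 1 - q i)) * (∏ i ∈ S', (if η₂ i then q i else 1 - q i))
      = ∏ i ∈ S', q i * (1 - q i) := by
    rw [← Finset.prod_mul_distrib]
    refine Finset.prod_congr rfl fun i hi => ?_
    have hne := hmix i hi
    cases h1i : η₁ i
    · have h2i : η₂ i = true := by
        cases h2i : η₂ i
        · exact absurd (h1i.trans h2i.symm) hne
        · rfl
      rw [h2i]; simp only [Bool.false_eq_true, if_false, if_true]; ring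
    · have h2i : η₂ i = false := by
        cases h2i : η₂ i
        · rfl
        · exact absurd (h1i.trans h2i.symm) hne
      rw [h2i]; simp only [Bool.false_eq_true, if_false, if_true]
  rw [hc1] at X1
  rw [hc2] at X2
  have hΦ1 : 0 ≤ ∏ i ∈ S', (if η₁ i then q i else 1 - q i) :=
    Finset.prod_nonneg fun i _ => by split_ifs; exacts [(hq i).1, sub_nonneg.2 (hq i).2]
  have hΦ2 : 0 ≤ ∏ i ∈ S', (if η₂ i then q i else 1 - q i) :=
    Finset.prod_nonneg fun i _ => by split_ifs; exacts [(hq i).1, sub_nonneg.2 (hq i).2]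
  -- jump comparisons `A − B ≤ D_a f(η₁^{e→1})`, `D − C ≤ D_a g(η₂^{e→0})`
  have hAB : pivDiff e (fun x => f (Function.update x a true)) η₁ - pivDiff e (fun x => f (Function.update x a false)) η₁
      ≤ pivDiff a f (Function.update η₁ e true) := by
    have hnn := pivDiff_nonneg hf a (Function.update η₁ e false)
    have hid : pivDiff e (fun x => f (Function.update x a true)) η₁ - pivDiff e (fun x => f (Function.update x a false)) η₁
        = pivDiff a f (Function.update η₁ e true) - pivDiff a f (Function.update η₁ e false) := by
      simp only [pivDiff]; ring
    linarith
  have hDC : pivDiff e (fun x => g (Function.update x a false)) η₂ - pivDiff e (fun x => g (Function.update x a true)) η₂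
      ≤ pivDiff a g (Function.update η₂ e false) := by
    have hnn := pivDiff_nonneg hg a (Function.update η₂ e true)
    have hid : pivDiff e (fun x => g (Function.update x a false)) η₂ - pivDiff e (fun x => g (Function.update x a true)) η₂
        = pivDiff a g (Function.update η₂ e false) - pivDiff a g (Function.update η₂ e true) := by
      simp only [pivDiff]; ring
    linarith
  -- assemble
  have hK0 : 0 ≤ q e * (1 - q e) := mul_nonneg (hq e).1 (sub_nonneg.2 (hq e).2)
  have hP0 : 0 ≤ ∏ i ∈ S', q i * (1 - q i) := Finset.prod_nonneg fun i _ => mul_nonneg (hq i).1 (sub_nonneg.2 (hq i).2)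
  have hX0 : 0 ≤ ex (prodWeight q) (pivDiff a f) := ex_nonneg hw (pivDiff_nonneg hf a)
  have hY0 : 0 ≤ ex (prodWeight q) (pivDiff a g) := ex_nonneg hw (pivDiff_nonneg hg a)
  have hXY : pivDiff e (fun x => f (Function.update x a false)) η₁ < pivDiff e (fun x => f (Function.update x a true)) η₁ →
      pivDiff e (fun x => g (Function.update x a true)) η₂ < pivDiff e (fun x => g (Function.update x a false)) η₂ →
      q e * (1 - q e) * (∏ i ∈ S', q i * (1 - q i)) *
          ((pivDiff e (fun x => f (Function.update x a true)) η₁ - pivDiff e (fun x => f (Function.update x a false)) η₁)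
            * (pivDiff e (fun x => g (Function.update x a false)) η₂ - pivDiff e (fun x => g (Function.update x a true)) η₂))
        ≤ ex (prodWeight q) (pivDiff a f) * ex (prodWeight q) (pivDiff a g) := by
    intro hBA hCD
    have l1 : q e * (∏ i ∈ S', (if η₁ i then q i else 1 - q i)) *
        (pivDiff e (fun x => f (Function.update x a true)) η₁ - pivDiff e (fun x => f (Function.update x a false)) η₁)
          ≤ ex (prodWeight q) (pivDiff a f) :=
      (mul_le_mul_of_nonneg_left hAB (mul_nonneg (hq e).1 hΦ1)).trans X1
    have l2 : (1 - q e) * (∏ i ∈ S', (if η₂ i then q i else 1 - q i)) *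
        (pivDiff e (fun x => g (Function.update x a false)) η₂ - pivDiff e (fun x => g (Function.update x a true)) η₂)
          ≤ ex (prodWeight q) (pivDiff a g) :=
      (mul_le_mul_of_nonneg_left hDC (mul_nonneg (sub_nonneg.2 (hq e).2) hΦ2)).trans X2
    have m2 : 0 ≤ (1 - q e) * (∏ i ∈ S', (if η₂ i then q i else 1 - q i)) *
        (pivDiff e (fun x => g (Function.update x a false)) η₂ - pivDiff e (fun x => g (Function.update x a true)) η₂) :=
      mul_nonneg (mul_nonneg (sub_nonneg.2 (hq e).2) hΦ2) (sub_nonneg.2 hCD.le)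
    have hm := mul_le_mul l1 l2 m2 hX0
    calc q e * (1 - q e) * (∏ i ∈ S', q i * (1 - q i)) *
          ((pivDiff e (fun x => f (Function.update x a true)) η₁ - pivDiff e (fun x => f (Function.update x a false)) η₁)
            * (pivDiff e (fun x => g (Function.update x a false)) η₂ - pivDiff e (fun x => g (Function.update x a true)) η₂))
        = (q e * (∏ i ∈ S', (if η₁ i then q i else 1 - q i)) *
            (pivDiff e (fun x => f (Function.update x a true)) η₁ - pivDiff e (fun x => f (Function.update x a false)) η₁))
          * ((1 - q e) * (∏ i ∈ S', (if η₂ i then q i else 1 - q i)) *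
            (pivDiff e (fun x => g (Function.update x a false)) η₂ - pivDiff e (fun x => g (Function.update x a true)) η₂)) := by
          rw [← hc12]; ring
      _ ≤ _ := hm
  rw [hAf, hDg, cov_split_update q a f g, ← ex_pivDiff_eq_sub, ← ex_pivDiff_eq_sub]
  exact mixed_step_arith (hq a).1 (sub_nonneg.2 (hq a).2) hK0 hP0 hA0 hB0 hC0 hD0 hX0 hY0 I1 I0 hXY

/-- **The two-atom floor, inductive form.**  For nonnegative monotone `f, g` depending only on the coordinates `insert e S` (`e ∉ S`)
and ANY configurations `η₁, η₂`:
`q_e(1−q_e)·D_e f(η₁)·D_e g(η₂)·Π_{i∈S} m_i ≤ Cov(f,g)`, `m_i = q_i / 1−q_i / q_i(1−q_i)` according as `η₁ i = η₂ i = 1 / = 0 / η₁ i ≠ η₂ i`.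
(Strong induction on `S`: freeze an agreeing coordinate by `cov_section_le`, else `twoAtom_mixed_step`.)
[cite: Harris1960, Lemma 4.1 (p. 16)] [cite: Talagrand1996, Thm. 1.1 (p. 244)] -/
theorem cov_ge_twoAtom_aux {q : ι → ℝ} (hq : ∀ i, 0 ≤ q i ∧ q i ≤ 1) (e : ι) (S : Finset ι) :
    e ∉ S → ∀ (f g : (ι → Bool) → ℝ), (∀ x, 0 ≤ f x) → (∀ x, 0 ≤ g x) → Monotone f → Monotone g →
      (∀ x a b, a ∉ insert e S → f (Function.update x a b) = f x) →
      (∀ x a b, a ∉ insert e S → g (Function.update x a b) = g x) →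
      ∀ η₁ η₂ : ι → Bool,
        q e * (1 - q e) * (pivDiff e f η₁ * pivDiff e g η₂) *
            ∏ i ∈ S, (if η₁ i = η₂ i then (if η₁ i then q i else 1 - q i) else q i * (1 - q i))
          ≤ ex (prodWeight q) (f * g) - ex (prodWeight q) f * ex (prodWeight q) g := by
  induction S using Finset.strongInduction with
  | H S ih =>
  intro heS f g hf0 hg0 hf hg hfS hgS η₁ η₂
  have hK0 : 0 ≤ q e * (1 - q e) := mul_nonneg (hq e).1 (sub_nonneg.2 (hq e).2)
  by_cases hagree : ∃ a ∈ S, η₁ a = η₂ a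
  · -- freeze an agreeing coordinate at the common value
    obtain ⟨a, haS, hagr⟩ := hagree
    have hae : a ≠ e := fun h => heS (h ▸ haS)
    have hsub : S.erase a ⊂ S := Finset.erase_ssubset haS
    have heS' : e ∉ S.erase a := fun h => heS (Finset.mem_of_mem_erase h)
    have hT : ∀ a', a' ∉ insert e (S.erase a) → a' ≠ a → a' ∉ insert e S := by
      intro a' ha' hne h'
      rcases Finset.mem_insert.1 h' with rfl | h''
      · exact ha' (Finset.mem_insert_self _ _)
      · exact ha' (Finset.mem_insert_of_mem (Finset.mem_erase.2 ⟨hne, h''⟩))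
    have IH := ih (S.erase a) hsub heS' (fun x => f (Function.update x a (η₁ a))) (fun x => g (Function.update x a (η₁ a)))
      (fun x => hf0 _) (fun x => hg0 _) (monotone_comp_update hf a _) (monotone_comp_update hg a _)
      (section_update_eq hfS a _ hT) (section_update_eq hgS a _ hT) η₁ η₂
    have hJf : pivDiff e (fun x => f (Function.update x a (η₁ a))) η₁ = pivDiff e f η₁ := by
      simp only [pivDiff, update_update_of_eq η₁ e a hae _ (η₁ a) rfl]
    have hJg : pivDiff e (fun x => g (Function.update x a (η₁ a))) η₂ = pivDiff e g η₂ := by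
      simp only [pivDiff, update_update_of_eq η₂ e a hae _ (η₁ a) hagr.symm]
    rw [hJf, hJg] at IH
    have hprod := Finset.mul_prod_erase S
      (fun i => if η₁ i = η₂ i then (if η₁ i then q i else 1 - q i) else q i * (1 - q i)) haS
    simp only [if_pos hagr] at hprod
    rw [← hprod]
    have hsec := cov_section_le hq a (η₁ a) hf0 hg0 hf hg
    have hfac0 : 0 ≤ (if η₁ a then q a else 1 - q a) := by
      split_ifs
      · exact (hq a).1
      · exact sub_nonneg.2 (hq a).2
    calc q e * (1 - q e) * (pivDiff e f η₁ * pivDiff e g η₂) *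
          ((if η₁ a = true then q a else 1 - q a) *
            ∏ i ∈ S.erase a, (if η₁ i = η₂ i then (if η₁ i then q i else 1 - q i) else q i * (1 - q i)))
        = (if η₁ a = true then q a else 1 - q a) * (q e * (1 - q e) * (pivDiff e f η₁ * pivDiff e g η₂) *
            ∏ i ∈ S.erase a, (if η₁ i = η₂ i then (if η₁ i then q i else 1 - q i) else q i * (1 - q i))) := by ring
      _ ≤ (if η₁ a = true then q a else 1 - q a) *
            (ex (prodWeight q) ((fun x => f (Function.update x a (η₁ a))) * fun x => g (Function.update x a (η₁ a)))
              - ex (prodWeight q) (fun x => f (Function.update x a (η₁ a)))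
                * ex (prodWeight q) (fun x => g (Function.update x a (η₁ a)))) :=
          mul_le_mul_of_nonneg_left IH hfac0
      _ ≤ _ := hsec
  · push Not at hagree
    rcases S.eq_empty_or_nonempty with hS0 | ⟨a, haS⟩
    · -- base: `f, g` depend on `e` only
      subst hS0
      rw [Finset.prod_empty, mul_one]
      have X1 := cyl_mul_le_ex hq ∅ (pivDiff e f) (pivDiff_nonneg hf e) (pivDiff_update_eq e hfS) η₁
      have X2 := cyl_mul_le_ex hq ∅ (pivDiff e g) (pivDiff_nonneg hg e) (pivDiff_update_eq e hgS) η₂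
      rw [Finset.prod_empty, one_mul] at X1 X2
      have hJ1 := pivDiff_nonneg hf e η₁
      have hJ2 := pivDiff_nonneg hg e η₂
      have h1 := cov_nonneg hq (fun x => hf0 _) (fun x => hg0 _) (monotone_comp_update hf e true)
        (monotone_comp_update hg e true)
      have h0 := cov_nonneg hq (fun x => hf0 _) (fun x => hg0 _) (monotone_comp_update hf e false)
        (monotone_comp_update hg e false)
      have hm := mul_le_mul X1 X2 hJ2 (hJ1.trans X1)
      rw [cov_split_update q e f g, ← ex_pivDiff_eq_sub, ← ex_pivDiff_eq_sub]
      nlinarith [mul_nonneg (hq e).1 h1, mul_nonneg (sub_nonneg.2 (hq e).2) h0, mul_le_mul_of_nonneg_left hm hK0]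
    · -- mixed step at `a`: the witnesses disagree on every coordinate of `S`
      have hae : a ≠ e := fun h => heS (h ▸ haS)
      have hsub : S.erase a ⊂ S := Finset.erase_ssubset haS
      have heS' : e ∉ S.erase a := fun h => heS (Finset.mem_of_mem_erase h)
      have hmix' : ∀ i ∈ S.erase a, η₁ i ≠ η₂ i := fun i hi => hagree i (Finset.mem_of_mem_erase hi)
      have hprod : ∏ i ∈ S, (if η₁ i = η₂ i then (if η₁ i then q i else 1 - q i) else q i * (1 - q i))
          = q a * (1 - q a) * ∏ i ∈ S.erase a, q i * (1 - q i) := by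
        have h := Finset.mul_prod_erase S
          (fun i => if η₁ i = η₂ i then (if η₁ i then q i else 1 - q i) else q i * (1 - q i)) haS
        simp only [if_neg (hagree a haS)] at h
        rw [← h]
        congr 1
        exact Finset.prod_congr rfl fun i hi => if_neg (hmix' i hi)
      rw [hprod]
      have hSe : insert e (insert a (S.erase a)) = insert e S := by rw [Finset.insert_erase haS]
      have hfS2 : ∀ x a' b, a' ∉ insert e (insert a (S.erase a)) → f (Function.update x a' b) = f x :=
        fun x a' b ha' => hfS x a' b (by rwa [hSe] at ha')
      have hgS2 : ∀ x a' b, a' ∉ insert e (insert a (S.erase a)) → g (Function.update x a' b) = g x :=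
        fun x a' b ha' => hgS x a' b (by rwa [hSe] at ha')
      -- the induction hypothesis at `S.erase a` in product form, for either order of the witnesses
      have ih' : ∀ θ₁ θ₂ : ι → Bool, (∀ i ∈ S.erase a, θ₁ i ≠ θ₂ i) →
          ∀ f' g' : (ι → Bool) → ℝ, (∀ x, 0 ≤ f' x) → (∀ x, 0 ≤ g' x) → Monotone f' → Monotone g' →
          (∀ x a' b, a' ∉ insert e (S.erase a) → f' (Function.update x a' b) = f' x) →
          (∀ x a' b, a' ∉ insert e (S.erase a) → g' (Function.update x a' b) = g' x) →
          q e * (1 - q e) * (pivDiff e f' θ₁ * pivDiff e g' θ₂) * (∏ i ∈ S.erase a, q i * (1 - q i))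
            ≤ ex (prodWeight q) (f' * g') - ex (prodWeight q) f' * ex (prodWeight q) g' := by
        intro θ₁ θ₂ hθ f' g' hf0' hg0' hf' hg' hf'S hg'S
        have h := ih (S.erase a) hsub heS' f' g' hf0' hg0' hf' hg' hf'S hg'S θ₁ θ₂
        rwa [Finset.prod_congr rfl fun i hi => if_neg (hθ i hi)] at h
      cases h1 : η₁ a
      · -- `η₁ a = 0`, so `η₂ a = 1`: the mixed step for `(g, f, η₂, η₁)`
        have h2 : η₂ a = true := by
          cases h2 : η₂ a
          · exact absurd (h1.trans h2.symm) (hagree a haS)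
          · rfl
        have hmix2 : ∀ i ∈ S.erase a, η₂ i ≠ η₁ i := fun i hi h => hmix' i hi h.symm
        have step := twoAtom_mixed_step hq e a hae (S.erase a) heS' g f hg0 hf0 hg hf hgS2 hfS2 η₂ η₁ h2 h1 hmix2
          (ih' η₂ η₁ hmix2)
        rw [mul_comm (pivDiff e g η₂), mul_comm g f, mul_comm (ex (prodWeight q) g)] at step
        exact step
      · have h2 : η₂ a = false := by
          cases h2 : η₂ a
          · rfl
          · exact absurd (h1.trans h2.symm) (hagree a haS)
        exact twoAtom_mixed_step hq e a hae (S.erase a) heS' f g hf0 hg0 hf hg hfS2 hgS2 η₁ η₂ h1 h2 hmix' (ih' η₁ η₂ hmix')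

/-- **THE TWO-ATOM FLOOR (sharp explicit strictness of Harris' inequality, cube form).**  Product weight `prodWeight q` on `ι → Bool`,
`q ∈ [0,1]^ι`; `f, g` nonnegative monotone; ANY coordinate `e` and configurations `η₁, η₂`.  Then
`q_e(1−q_e) · (f(η₁^{e→1}) − f(η₁^{e→0})) · (g(η₂^{e→1}) − g(η₂^{e→0})) · Π_{i ≠ e} m_i ≤ E(fg) − E f·E g`,
`m_i = q_i` (`η₁ i = η₂ i = 1`), `1 − q_i` (`η₁ i = η₂ i = 0`), `q_i(1−q_i)` (`η₁ i ≠ η₂ i`).  Equality for `f = AND`, `g = OR`,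
`η₁ = 1`, `η₂ = 0` (`cov_and_or_eq_prod`). [cite: Harris1960, Lemma 4.1 (p. 16)] [cite: Talagrand1996, Thm. 1.1 (p. 244)] -/
theorem cov_ge_twoAtom {q : ι → ℝ} (hq : ∀ i, 0 ≤ q i ∧ q i ≤ 1) (f g : (ι → Bool) → ℝ)
    (hf0 : ∀ x, 0 ≤ f x) (hg0 : ∀ x, 0 ≤ g x) (hf : Monotone f) (hg : Monotone g) (e : ι) (η₁ η₂ : ι → Bool) :
    q e * (1 - q e) * (pivDiff e f η₁ * pivDiff e g η₂) *
        ∏ i ∈ (univ : Finset ι).erase e, (if η₁ i = η₂ i then (if η₁ i then q i else 1 - q i) else q i * (1 - q i))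
      ≤ ex (prodWeight q) (f * g) - ex (prodWeight q) f * ex (prodWeight q) g := by
  have hu : insert e ((univ : Finset ι).erase e) = univ := Finset.insert_erase (Finset.mem_univ e)
  exact cov_ge_twoAtom_aux hq e ((univ : Finset ι).erase e) (Finset.notMem_erase e univ) f g hf0 hg0 hf hg
    (fun x a b ha => absurd (by rw [hu]; exact Finset.mem_univ a) ha)
    (fun x a b ha => absurd (by rw [hu]; exact Finset.mem_univ a) ha) η₁ η₂


end QuantHarris

end Summit.CriticalPhenomena.PercolationContinuityZ3.Theorems

end
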